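import Summits.QuantumFields.BalabanUV.Beta.FP.KernelPeriodisationFibWoundLimit
import Summits.QuantumFields.BalabanUV.Beta.GAN24.SecondOrderCarrierParity

/-!
# `BalabanUV.Beta.FP.KernelPeriodisationFibWoundLetter` — row D1 ∕ (C1), PART 15c: **THE WINDING LETTER OF A SWAP-SYMMETRIC SECOND-ORDER VERTEX
# FAMILY IS A THEOREM AT ITS `VertexFamily₂` LETTER** — the ADOPTED separation letter (road FP g43 SPEC-55 §3) follows from `VertexFamily₂` + the
# swap symmetry `W ν y′ μ y = W μ y ν y′` by lit `BalabanStepW2.biLoc_far_of_pair`, for the family and for its EVEN HALF `W♮ = ½(W + (W)ᴾ)`; composed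
# with PART 15b `winding_letter_translate` this DISCHARGES the END wrapper v5's ∕ `TowerKernelLawNamedC`'s winding letter `hWNw` from the letters
# v5 already carries (`hWN : VertexFamily₂ (WN …)`, `TowerNParityRowsEven.WN_swap`, the box sentences, the leg's decay ∕ invariance)

WHY.  (R1) «wound rows» (road FP g42 A-1 l.67696) put the source-wound EVEN family `Σ'_e WN♮ μ y ν (y′ + Mc_B∘e)` in the second-order torus rows and
ONE winding letter per system in the law (`hW?w : trace(perF A · perF (dper (wound))) − trace(perF A · perF (dper (unwound))) → 0`).  PART 15b proved
it under the separation letter `∀ s, BiLoc (V s) p q (Cw·e^{−δs|N•s − p₀|₁}) δ`.  For a swap-symmetric `VertexFamily₂` family that letter is FREE: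
`W μ y ν y′` is bi-localised at `(N•y, N•y′)` AND (by the swap) at `(N•y′, N•y)` with the same constants, hence (lit `biLoc_far_of_pair`: `max ≥ mean`
+ two triangle inequalities) at `(N•y, N•y)` with constant `Cw·e^{−(δ∕2)|N•y′ − N•y|₁}`, rate `δ∕4` (§1); the even half of a swap-symmetric family is
swap-symmetric and `VertexFamily₂` with the same constants (GAN24 `vertexFamily₂_evenHalf_of_swap`), so the same holds for `W♮` (§1); §2 is 15b
`winding_letter_translate` at these letters, in v5's displayed shape.

WHAT ([folklore] BY NAME; generic dimension `d`, fibre `Fib d`; no `def`, no `def … : Prop`, nothing cited, 0 sorry): §1 **`biLoc_sep_of_swap`**,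
`evenHalf_swap`, **`biLoc_sep_evenHalf_of_swap`**; §2 **`winding_letter_of_swap`**, **`winding_letter_evenHalf_of_swap`** (v5's `hWNw n μ ν z` is the
latter at `T := B ↦ towerTorus Lc (fine Lc (Mc B)) (n+1)`, `A := AN (Roots.ctr Lc) (n+1)`, `W := WN (Roots.ctr Lc) Pn (n+1)`, `y := 0`,
`hs := WN_swap …`, `hW := hWN n`), `tendsto_trace_tadpole_evenHalf_of_swap` (the limit itself, value `tadpole A (W♮ μ y ν z)`).
WHAT THIS IS NOT: no row of the END wrapper is re-typed here (the road instantiates); nothing of Bałaban's asserted, valued or discharged; 0 estimates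
beyond [folklore]; 0∕4 row-D1 binders (hW, hR, D1Tel, D1Rep); ROOT M‴ p325680 ∕ P5c ∕ D6 untouched; NOT (C1), NOT (T-ID), NOT D1, NEVER «G-an2-4 closed»,
NOT BetaPertH, NOT continuum, NOT Clay.

HONEST DEPENDENCY (page 1, mandatory): continuum YM on T⁴ ⇐ BetaPertH ∧ nine spine estimates (0/9 proved); BetaPertH ⇐ (D1) ∧ (D4) ∧ CAP+tail;
G-an2-4 gates asym, D1 and NE2/3/4.  HONEST FRAMING (cell contract, verbatim): «discharging `BetaPertH` makes Bałaban's UV stability UNCONDITIONAL —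
a real constructive-QFT result; it is NOT the continuum limit and NOT the Clay problem.»  ABSOLUTE RULE (cell charter, verbatim): «No internally-minted
statement may enter as a cited fact. Every hypothesis is either kernel-proved in this package or a verbatim quotation of a PUBLISHED theorem with page
reference. The manuscript(s) under audit are NOT citable for their own disputed steps — they are the thing under adjudication; programme-internal
(2001/route/tribunal) claims are never citable.»  Row D1 ∕ (C1) OWNER an2 (b2b-balaban-beta-an2) gen 68, 2026-08-27.  No existing file touched.
-/

noncomputable section

open scoped BigOperators Matrix Topology
open Finset Filter

namespace Summit.QuantumFields.BalabanUV.Beta.FP.KernelPeriodisationFibWoundLetter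

open Literature.MathematicalPhysics.QuantumFieldTheory.Balaban1983to89
open Literature.MathematicalPhysics.QuantumFieldTheory.Balaban1983to89.Beta
open B12Sec2to5 (l1 l1_nonneg)
open B4TorusKernel.MultiPeriod (translate)
open ExpKernelCalculus (MKer Decays BiLoc VertexFamily₂ tadpole)
open OneStepResolventKernel (Fib)
open BalabanStepW2 (biLoc_far_of_pair)
open Summit.QuantumFields.BalabanUV.Beta.TameKernelCalculus (trK)
open Summit.QuantumFields.BalabanUV.Beta.BorderedHessian (sgnK)
open Summit.QuantumFields.BalabanUV.Beta.GAN24.SecondOrderCarrierParity (vertexFamily₂_evenHalf_of_swap)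
open Summit.QuantumFields.BalabanUV.Beta.FP.KernelPeriodisationFib (perF)
open Summit.QuantumFields.BalabanUV.Beta.FP.KernelPeriodisationFibLoc (dper)
open Summit.QuantumFields.BalabanUV.Beta.FP.KernelPeriodisationFibWoundLimit (winding_letter_translate tendsto_trace_tadpole_translate)

variable {d : ℕ}

/-! ## §1 The separation letter of a swap-symmetric `VertexFamily₂` family and of its even half -/

section Letter

variable {W : Fin (d + 1) → (Fin (d + 1) → ℤ) → Fin (d + 1) → (Fin (d + 1) → ℤ) → MKer (d + 1) (Fib d)} {N : ℕ} {Cw δ : ℝ}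

/-- [folklore] **`biLoc_sep_of_swap` — THE ADOPTED SEPARATION LETTER IS FREE FOR A SWAP-SYMMETRIC `VertexFamily₂` FAMILY**: `W μ y ν y′` is
bi-localised at `(N•y, N•y)` with constant `Cw·e^{−(δ∕2)|N•y′ − N•y|₁}` and rate `δ∕4` (lit `biLoc_far_of_pair` on the pair of localisations
`(N•y, N•y′)` ∕ `(N•y′, N•y)`, the second from the swap). -/
theorem biLoc_sep_of_swap (hs : ∀ μ y ν y', W ν y' μ y = W μ y ν y') (hW : VertexFamily₂ W N Cw δ) (hδ : 0 ≤ δ)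
    (μ : Fin (d + 1)) (y : Fin (d + 1) → ℤ) (ν : Fin (d + 1)) (y' : Fin (d + 1) → ℤ) :
    BiLoc (W μ y ν y') ((N : ℤ) • y) ((N : ℤ) • y) (Cw * Real.exp (-(δ / 2) * l1 ((N : ℤ) • y' - (N : ℤ) • y))) (δ / 4) := by
  have h₁ : BiLoc (W μ y ν y') ((N : ℤ) • y) ((N : ℤ) • y') Cw δ := hW μ y ν y'
  have h₂ : BiLoc (W μ y ν y') ((N : ℤ) • y') ((N : ℤ) • y) Cw δ := by
    rw [← hs μ y ν y']
    exact hW ν y' μ y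
  exact biLoc_far_of_pair h₁ h₂ hδ

/-- [folklore] the even half `W♮ μ y ν y′ = ½(W μ y ν y′ + (W μ y ν y′)ᴾ)` of a swap-symmetric family is swap-symmetric. -/
theorem evenHalf_swap (hs : ∀ μ y ν y', W ν y' μ y = W μ y ν y')
    (μ : Fin (d + 1)) (y : Fin (d + 1) → ℤ) (ν : Fin (d + 1)) (y' : Fin (d + 1) → ℤ) :
    (fun μ y ν y' => (1 / 2 : ℝ) • (W μ y ν y' + sgnK (trK (W μ y ν y')))) ν y' μ y
      = (fun μ y ν y' => (1 / 2 : ℝ) • (W μ y ν y' + sgnK (trK (W μ y ν y')))) μ y ν y' := by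
  simp only [hs]

/-- [folklore] **`biLoc_sep_evenHalf_of_swap` — THE SAME LETTER FOR THE EVEN HALF** (GAN24 `vertexFamily₂_evenHalf_of_swap` + `evenHalf_swap` into
`biLoc_sep_of_swap`): `BiLoc (½(W μ y ν y′ + (W μ y ν y′)ᴾ)) (N•y) (N•y) (Cw·e^{−(δ∕2)|N•y′ − N•y|₁}) (δ∕4)`. -/
theorem biLoc_sep_evenHalf_of_swap (hs : ∀ μ y ν y', W ν y' μ y = W μ y ν y') (hW : VertexFamily₂ W N Cw δ) (hδ : 0 ≤ δ)
    (μ : Fin (d + 1)) (y : Fin (d + 1) → ℤ) (ν : Fin (d + 1)) (y' : Fin (d + 1) → ℤ) :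
    BiLoc ((1 / 2 : ℝ) • (W μ y ν y' + sgnK (trK (W μ y ν y')))) ((N : ℤ) • y) ((N : ℤ) • y)
      (Cw * Real.exp (-(δ / 2) * l1 ((N : ℤ) • y' - (N : ℤ) • y))) (δ / 4) :=
  biLoc_sep_of_swap (W := fun μ y ν y' => (1 / 2 : ℝ) • (W μ y ν y' + sgnK (trK (W μ y ν y'))))
    (evenHalf_swap hs) (vertexFamily₂_evenHalf_of_swap hs hW) hδ μ y ν y'

end Letter

/-! ## §2 The winding letter of the law v-next ∕ v5, discharged for swap-symmetric `VertexFamily₂` families and their even halves -/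

section Winding

variable {A : MKer (d + 1) (Fib d)} {CA α : ℝ}
  {W : Fin (d + 1) → (Fin (d + 1) → ℤ) → Fin (d + 1) → (Fin (d + 1) → ℤ) → MKer (d + 1) (Fib d)} {N : ℕ} {Cw δ : ℝ}

/-- [folklore] **`winding_letter_of_swap` — THE WINDING LETTER FOR THE SOURCE-WOUND FAMILY ITSELF**: torus boxes `T k` and source boxes `Mc k` growing,
a decaying `T_kℤ`-invariant leg `A`, `W` a swap-symmetric `VertexFamily₂` family (blocking `N ≥ 1`, rate `δ > 0`); then for every `μ y ν z`
`trace (perF (T k) A * perF (T k) (dper (T k) (x w ↦ Σ'_e W μ y ν (z + Mc_k∘e) x w))) − trace (perF (T k) A * perF (T k) (dper (T k) (W μ y ν z))) → 0`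
(15b `winding_letter_translate` at §1's letter: `p = q = p₀ = N•y`, `δs = δ∕2`, rate `δ∕4`). -/
theorem winding_letter_of_swap (T Mc : ℕ → (Fin (d + 1) → ℕ)) [∀ k μ, NeZero (T k μ)] [∀ k μ, NeZero (Mc k μ)]
    (hT : ∀ K : ℕ, ∀ᶠ k in atTop, ∀ i, K ≤ T k i) (hMc : ∀ K : ℕ, ∀ᶠ k in atTop, ∀ i, K ≤ Mc k i)
    (hA : Decays A CA α) (hα : 0 < α)
    (hAinv : ∀ k (m x y : Fin (d + 1) → ℤ) (a b : Fib d), A (translate (T k) x m) (translate (T k) y m) a b = A x y a b)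
    [NeZero N] (hs : ∀ μ y ν y', W ν y' μ y = W μ y ν y') (hW : VertexFamily₂ W N Cw δ) (hδ : 0 < δ)
    (μ : Fin (d + 1)) (y : Fin (d + 1) → ℤ) (ν : Fin (d + 1)) (z : Fin (d + 1) → ℤ) :
    Tendsto (fun k => Matrix.trace (perF (T k) A * perF (T k) (dper (T k) (fun x w a b => ∑' e, W μ y ν (translate (Mc k) z e) x w a b)))
        - Matrix.trace (perF (T k) A * perF (T k) (dper (T k) (W μ y ν z)))) atTop (𝓝 0) :=
  winding_letter_translate T Mc hT hMc hA hα hAinv (fun s => W μ y ν s) z N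
    (fun s => biLoc_sep_of_swap hs hW hδ.le μ y ν s) (by positivity) (by positivity)

/-- [folklore] **`winding_letter_evenHalf_of_swap` — v5's `hWNw` ∕ NamedC's `hWNw` SHAPE, DISCHARGED**: the same for the source-wound EVEN family
`x w ↦ Σ'_e (½(W μ y ν (z + Mc_k∘e) + (W μ y ν (z + Mc_k∘e))ᴾ)) x w` against its unwound member `½(W μ y ν z + (W μ y ν z)ᴾ)`.  At the record
(`d = 3`): `T := B ↦ towerTorus Lc (fine Lc (Mc B)) (n+1)`, `A := AN (Roots.ctr Lc) (n+1)`, `W := WN (Roots.ctr Lc) Pn (n+1)`, `y := 0`,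
`hs := TowerNParityRowsEven.WN_swap …`, `hW := hWN n` — CHARACTER FOR CHARACTER v5's `hWNw n μ ν z`. -/
theorem winding_letter_evenHalf_of_swap (T Mc : ℕ → (Fin (d + 1) → ℕ)) [∀ k μ, NeZero (T k μ)] [∀ k μ, NeZero (Mc k μ)]
    (hT : ∀ K : ℕ, ∀ᶠ k in atTop, ∀ i, K ≤ T k i) (hMc : ∀ K : ℕ, ∀ᶠ k in atTop, ∀ i, K ≤ Mc k i)
    (hA : Decays A CA α) (hα : 0 < α)
    (hAinv : ∀ k (m x y : Fin (d + 1) → ℤ) (a b : Fib d), A (translate (T k) x m) (translate (T k) y m) a b = A x y a b)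
    [NeZero N] (hs : ∀ μ y ν y', W ν y' μ y = W μ y ν y') (hW : VertexFamily₂ W N Cw δ) (hδ : 0 < δ)
    (μ : Fin (d + 1)) (y : Fin (d + 1) → ℤ) (ν : Fin (d + 1)) (z : Fin (d + 1) → ℤ) :
    Tendsto (fun k => Matrix.trace (perF (T k) A * perF (T k) (dper (T k) (fun x w a b => ∑' e,
          ((1 / 2 : ℝ) • (W μ y ν (translate (Mc k) z e) + sgnK (trK (W μ y ν (translate (Mc k) z e))))) x w a b)))
        - Matrix.trace (perF (T k) A * perF (T k) (dper (T k) ((1 / 2 : ℝ) • (W μ y ν z + sgnK (trK (W μ y ν z))))))) atTop (𝓝 0) :=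
  winding_letter_translate T Mc hT hMc hA hα hAinv (fun s => (1 / 2 : ℝ) • (W μ y ν s + sgnK (trK (W μ y ν s)))) z N
    (fun s => biLoc_sep_evenHalf_of_swap hs hW hδ.le μ y ν s) (by positivity) (by positivity)

/-- [folklore] **`tendsto_trace_tadpole_evenHalf_of_swap` — THE LIMIT ITSELF** for the source-wound even family: value `tadpole A (½(W μ y ν z + (W μ y ν z)ᴾ))`
(15b `tendsto_trace_tadpole_translate` at §1's letter). -/
theorem tendsto_trace_tadpole_evenHalf_of_swap (T Mc : ℕ → (Fin (d + 1) → ℕ)) [∀ k μ, NeZero (T k μ)] [∀ k μ, NeZero (Mc k μ)]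
    (hT : ∀ K : ℕ, ∀ᶠ k in atTop, ∀ i, K ≤ T k i) (hMc : ∀ K : ℕ, ∀ᶠ k in atTop, ∀ i, K ≤ Mc k i)
    (hA : Decays A CA α) (hα : 0 < α)
    (hAinv : ∀ k (m x y : Fin (d + 1) → ℤ) (a b : Fib d), A (translate (T k) x m) (translate (T k) y m) a b = A x y a b)
    [NeZero N] (hs : ∀ μ y ν y', W ν y' μ y = W μ y ν y') (hW : VertexFamily₂ W N Cw δ) (hδ : 0 < δ)
    (μ : Fin (d + 1)) (y : Fin (d + 1) → ℤ) (ν : Fin (d + 1)) (z : Fin (d + 1) → ℤ) :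
    Tendsto (fun k => Matrix.trace (perF (T k) A * perF (T k) (dper (T k) (fun x w a b => ∑' e,
          ((1 / 2 : ℝ) • (W μ y ν (translate (Mc k) z e) + sgnK (trK (W μ y ν (translate (Mc k) z e))))) x w a b)))) atTop
      (𝓝 (tadpole A ((1 / 2 : ℝ) • (W μ y ν z + sgnK (trK (W μ y ν z)))))) :=
  tendsto_trace_tadpole_translate T Mc hT hMc hA hα hAinv (fun s => (1 / 2 : ℝ) • (W μ y ν s + sgnK (trK (W μ y ν s)))) z N
    (fun s => biLoc_sep_evenHalf_of_swap hs hW hδ.le μ y ν s) (by positivity) (by positivity)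

end Winding

end Summit.QuantumFields.BalabanUV.Beta.FP.KernelPeriodisationFibWoundLetter

end
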